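import Literature.MeasureTheory.RestrictedProduct.ProductMeasureRestrict
import Mathlib.MeasureTheory.Group.Measure

/-!
# Restricted product measures, IV: left-invariance for restricted products of groups

Topic `MeasureTheory/RestrictedProduct`; continues `LevelMeasure` / `ProductMeasure` /
`ProductMeasureRestrict`. The GROUP half of Tate's statement (Cassels–Fröhlich (1967) Ch. XV §3.3,
PDF pp. 352–353 [CasselsFrohlichANT1967]: the restricted product measure of Haar measures is "a Haar
measure `dα` on `G`"; Leahy (2010) Prop. 3.1.8): for measurable groups `G i`, subgroups `B i ≤ G i`
(measurable as sets, `ν i (B i) = 1` off `S₀`) and LEFT-INVARIANT σ-finite local measures `ν i`,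
the restricted product measure `rpMeasure (fun i => B i) ν S₀` on the group `Πʳ i, [G i, B i]` is
left-invariant. No topology is used.

* `measurable_mul_left`, `measurable_mul_right`, `instMeasurableMul` — translations of
  `Πʳ i, [G i, B i]` are measurable for the trace σ-algebra of `ProductMeasure` (countable `ι`);
* `mulK`, `map_mulK_rho` — coordinatewise translation on the compact factor `Π_{i∉S} B_i` preserves
  `ρ_S` (box-wise, via `Measure.eq_infinitePi`);
* `preimage_mul_left_rpBox`, `mul_left_comp_glue` — translation by `a` preserves `A_S` and is
  coordinatewise in the coordinates `e_S`, once `a_i ∈ B_i` for `i ∉ S`;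
* `map_mul_left_rpMeasure`, `isMulLeftInvariant_rpMeasure` — **left-invariance**: reduce by the
  uniqueness theorem `ext_of_restrict_rpBox` (base `S₀ ∪ {i | a_i ∉ B_i}`) to the cylinders, where
  `μ|_{A_S}` is the pushed-forward product measure (`rpMeasure_restrict_rpBox`) and a product of
  left-invariant measures is left-invariant.

Everything is proved (Mathlib only). Not here: the Haar / regularity classes (`IsHaarMeasure`), which
need the identification of the trace σ-algebra with the Borel σ-algebra of the restricted-product
topology (separate files).

## Provenance

Reproduced for the tree under the LEAN-IN-TREE rule (2026-08-18) from the pub-hodgecm cell's package file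
`HodgeCM/PerL34/RestrictedMeasureHaar.lean` (DAG-node prover #09 lineage, seat pv09-g2, gate run 22),
§§ "Measurability of translations" – "Left-invariance" verbatim up to the namespace
(`HodgeCM.PerL34.RestrictedMeasure` ↦ `Literature.MeasureTheory.RestrictedProduct`) and the added docstrings;
the package file's last section (`RestrictedProductMeasureDatum.ofHaar`, an adapter to another package
structure) is not part of this file.
-/

set_option autoImplicit false

noncomputable section

open _root_.MeasureTheory Set Filter Function

open scoped RestrictedProduct ENNReal

namespace Literature.MeasureTheory.RestrictedProduct

universe u v

variable {ι : Type u} {G : ι → Type v} [∀ i, MeasurableSpace (G i)] [∀ i, Group (G i)]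
  [∀ i, MeasurableMul (G i)] (B : ∀ i, Subgroup (G i)) (ν : ∀ i, Measure (G i))

/-! ## Measurability of translations on `Πʳ i, [G i, B i]` -/

section measurable

variable [Countable ι]

omit [∀ i, MeasurableSpace (G i)] [∀ i, MeasurableMul (G i)] [Countable ι] in
/-- The inclusion into `Π i, G i` is multiplicative. [folklore] -/
theorem incl_mul (a x : Πʳ i, [G i, B i]) :
    incl (fun i => (B i : Set (G i))) (a * x) =
      incl (fun i => (B i : Set (G i))) a * incl (fun i => (B i : Set (G i))) x := rfl

/-- Left translations of `Πʳ i, [G i, B i]` are measurable (trace σ-algebra, countable `ι`). [folklore] -/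
theorem measurable_mul_left (hBm : ∀ i, MeasurableSet (B i : Set (G i))) (a : Πʳ i, [G i, B i]) :
    Measurable (a * ·) := by
  refine (measurableEmbedding_incl (fun i => (B i : Set (G i))) hBm).measurable_comp_iff.1 ?_
  have : incl (fun i => (B i : Set (G i))) ∘ (a * ·) =
      (incl (fun i => (B i : Set (G i))) a * ·) ∘ incl (fun i => (B i : Set (G i))) := rfl
  rw [this]
  exact (measurable_const_mul _).comp (measurable_incl _ hBm)

/-- Right translations of `Πʳ i, [G i, B i]` are measurable (trace σ-algebra, countable `ι`). [folklore] -/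
theorem measurable_mul_right (hBm : ∀ i, MeasurableSet (B i : Set (G i))) (a : Πʳ i, [G i, B i]) :
    Measurable (· * a) := by
  refine (measurableEmbedding_incl (fun i => (B i : Set (G i))) hBm).measurable_comp_iff.1 ?_
  have : incl (fun i => (B i : Set (G i))) ∘ (· * a) =
      (· * incl (fun i => (B i : Set (G i))) a) ∘ incl (fun i => (B i : Set (G i))) := rfl
  rw [this]
  exact (measurable_mul_const _).comp (measurable_incl _ hBm)

/-- `Πʳ i, [G i, B i]` is a measurable group (translations measurable) for our σ-algebra. [folklore] -/
theorem instMeasurableMul (hBm : ∀ i, MeasurableSet (B i : Set (G i))) :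
    MeasurableMul (Πʳ i, [G i, B i]) :=
  ⟨measurable_mul_left B hBm, measurable_mul_right B hBm⟩

end measurable

/-! ## Translation on the compact factor `Π_{i∉S} B_i` and invariance of `ρ_S` -/

section compactFactor

variable (hKne : ∀ i, ((B i : Set (G i))).Nonempty)

/-- Coordinatewise left translation by `a` on `Π_{i∉S} B_i` (for `a_i ∈ B_i`, `i ∉ S`). [folklore] -/
def mulK (S : Finset ι) (a : Πʳ i, [G i, B i]) (ha : ∀ i, i ∉ S → a i ∈ B i)
    (z : (i : {i // i ∉ S}) → ((B i : Subgroup (G i)) : Set (G i))) :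
    (i : {i // i ∉ S}) → ((B i : Subgroup (G i)) : Set (G i)) :=
  fun i => ⟨a i * (z i : G i), (B (i : ι)).mul_mem (ha i i.2) (z i).2⟩

omit [∀ i, MeasurableSpace (G i)] [∀ i, MeasurableMul (G i)] in
/-- Coordinates of the translation `mulK`. [folklore] -/
@[simp] theorem coe_mulK_apply (S : Finset ι) (a : Πʳ i, [G i, B i]) (ha : ∀ i, i ∉ S → a i ∈ B i)
    (z : (i : {i // i ∉ S}) → ((B i : Subgroup (G i)) : Set (G i))) (i : {i // i ∉ S}) :
    ((mulK B S a ha z i : ((B i : Subgroup (G i)) : Set (G i))) : G i) = a i * (z i : G i) := rfl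

/-- The coordinatewise translation `mulK` is measurable. [folklore] -/
theorem measurable_mulK (S : Finset ι) (a : Πʳ i, [G i, B i]) (ha : ∀ i, i ∉ S → a i ∈ B i) :
    Measurable (mulK B S a ha) :=
  measurable_pi_lambda _ fun i =>
    ((measurable_subtype_coe.comp (measurable_pi_apply i)).const_mul (a i)).subtype_mk

/-- The local factor `ν_i|B_i` (as a measure on the subtype) is invariant under left translation by
an element of `B_i`, when `ν_i` is left-invariant. [folklore] -/
theorem kap_preimage_mul [∀ i, Measure.IsMulLeftInvariant (ν i)] {i : ι}
    (hBm : MeasurableSet (B i : Set (G i))) (h1 : ν i (B i : Set (G i)) = 1) {g : G i} (hg : g ∈ B i)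
    (t : Set ((B i : Subgroup (G i)) : Set (G i))) :
    kap (fun i => (B i : Set (G i))) ν hKne i
        ((fun k => (⟨g * (k : G i), (B i).mul_mem hg k.2⟩ : ((B i : Subgroup (G i)) : Set (G i))))
          ⁻¹' t) =
      kap (fun i => (B i : Set (G i))) ν hKne i t := by
  have hemb := MeasurableEmbedding.subtype_coe hBm
  rw [kap, if_pos h1, hemb.comap_apply, hemb.comap_apply]
  have himg : Subtype.val '' ((fun k : ((B i : Subgroup (G i)) : Set (G i)) =>
      (⟨g * (k : G i), (B i).mul_mem hg k.2⟩ : ((B i : Subgroup (G i)) : Set (G i)))) ⁻¹' t) =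
      (g * ·) ⁻¹' (Subtype.val '' t) := by
    ext x
    constructor
    · rintro ⟨k, hk, rfl⟩
      exact ⟨_, hk, rfl⟩
    · rintro ⟨k', hk', hk'eq⟩
      have hx : x ∈ B i := by
        have : x = g⁻¹ * (k' : G i) := by rw [hk'eq, inv_mul_cancel_left]
        rw [this]
        exact (B i).mul_mem ((B i).inv_mem hg) k'.2
      refine ⟨⟨x, hx⟩, ?_, rfl⟩
      have hk : (⟨g * x, (B i).mul_mem hg hx⟩ : ((B i : Subgroup (G i)) : Set (G i))) = k' :=
        Subtype.ext hk'eq.symm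
      show (⟨g * x, (B i).mul_mem hg hx⟩ : ((B i : Subgroup (G i)) : Set (G i))) ∈ t
      rw [hk]
      exact hk'
  rw [himg, measure_preimage_mul]

/-- **Invariance of the compact factor**: `(mulK a)_* ρ_S = ρ_S` when `a_i ∈ B_i` and
`ν_i(B_i) = 1` for `i ∉ S` and the `ν_i` are left-invariant. [folklore] -/
theorem map_mulK_rho [∀ i, Measure.IsMulLeftInvariant (ν i)] (hBm : ∀ i, MeasurableSet (B i : Set (G i)))
    {S : Finset ι} (hB1 : ∀ i, i ∉ S → ν i (B i : Set (G i)) = 1)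
    (a : Πʳ i, [G i, B i]) (ha : ∀ i, i ∉ S → a i ∈ B i) :
    (rho (fun i => (B i : Set (G i))) ν hKne S).map (mulK B S a ha) =
      rho (fun i => (B i : Set (G i))) ν hKne S := by
  haveI : ∀ i : {i // i ∉ S}, IsProbabilityMeasure (kap (fun i => (B i : Set (G i))) ν hKne i) :=
    fun i => isProbabilityMeasure_kap _ ν hKne hBm i
  unfold rho
  refine Measure.eq_infinitePi _ fun s t ht => ?_
  rw [Measure.map_apply (measurable_mulK B S a ha) (MeasurableSet.pi s.countable_toSet fun i _ => ht i)]
  have hpre : mulK B S a ha ⁻¹' Set.pi ↑s t = Set.pi ↑s fun i : {i // i ∉ S} =>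
      (fun k : ((B (i : ι) : Subgroup (G i)) : Set (G i)) =>
        (⟨a i * (k : G i), (B (i : ι)).mul_mem (ha i i.2) k.2⟩ :
          ((B (i : ι) : Subgroup (G i)) : Set (G i)))) ⁻¹' t i := by
    ext z
    simp only [mem_preimage, Set.mem_pi]
    rfl
  rw [hpre, Measure.infinitePi_pi (fun i : {i // i ∉ S} => kap (fun i => (B i : Set (G i))) ν hKne i)
    (fun (i : {i // i ∉ S}) _ => (measurable_subtype_coe.const_mul (a i)).subtype_mk (ht i))]
  exact Finset.prod_congr rfl fun i _ =>
    kap_preimage_mul B ν hKne (hBm i) (hB1 i i.2) (ha i i.2) (t i)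

end compactFactor

/-! ## Left-invariance of the restricted product measure -/

section invariance

variable [Countable ι] [∀ i, SigmaFinite (ν i)]

omit [∀ i, MeasurableSpace (G i)] [∀ i, MeasurableMul (G i)] [Countable ι] [∀ i, SigmaFinite (ν i)] in
/-- Translation by `a` preserves the cylinder `A_S` as soon as `a_i ∈ B_i` for `i ∉ S`. [folklore] -/
theorem preimage_mul_left_rpBox {S : Finset ι} (a : Πʳ i, [G i, B i])
    (ha : ∀ i, i ∉ S → a i ∈ B i) :
    (a * ·) ⁻¹' rpBox (fun i => (B i : Set (G i))) S = rpBox (fun i => (B i : Set (G i))) S := by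
  ext x
  simp only [mem_preimage, rpBox, mem_setOf_eq, RestrictedProduct.mul_apply]
  exact forall₂_congr fun i hi => (B i).mul_mem_cancel_left (ha i hi)

omit [∀ i, MeasurableSpace (G i)] [∀ i, MeasurableMul (G i)] [Countable ι] [∀ i, SigmaFinite (ν i)] in
/-- The gluing map intertwines translation by `a` on `Πʳ` with the coordinatewise translation on
`(Π_{i∈S} G_i) × (Π_{i∉S} B_i)`. [folklore] -/
theorem mul_left_comp_glue (S : Finset ι) (a : Πʳ i, [G i, B i]) (ha : ∀ i, i ∉ S → a i ∈ B i) :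
    (a * ·) ∘ glue (fun i => (B i : Set (G i))) S =
      glue (fun i => (B i : Set (G i))) S ∘
        Prod.map ((fun i : {i // i ∈ S} => a i) * ·) (mulK B S a ha) := by
  funext p
  refine RestrictedProduct.ext _ _ fun i => ?_
  show a i * (split S).symm (p.1, fun j => ((p.2 j : ((B j : Subgroup (G j)) : Set (G j))) : G j)) i =
    (split S).symm ((fun j : {j // j ∈ S} => a j) * p.1,
      fun j => ((mulK B S a ha p.2 j : ((B j : Subgroup (G j)) : Set (G j))) : G j)) i
  by_cases hi : i ∈ S
  · rw [split_symm_apply_of_mem (G := G) S _ hi, split_symm_apply_of_mem (G := G) S _ hi]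
    rfl
  · rw [split_symm_apply_of_not_mem (G := G) S _ hi, split_symm_apply_of_not_mem (G := G) S _ hi]
    rfl

/-- **Left-invariance of the restricted product measure** (the group half of Leahy Prop. 3.1.8):
if the local measures are left-invariant, `B_i ≤ G_i` are measurable subgroups with `ν_i(B_i) = 1`
off `S₀`, then `(a · _)_* μ = μ` for every `a ∈ Πʳ i, [G i, B i]`. [cite: CasselsFrohlichANT1967, Ch. XV (Tate) §3.3, PDF pp. 352–353] -/
theorem map_mul_left_rpMeasure [∀ i, Measure.IsMulLeftInvariant (ν i)]
    (hBm : ∀ i, MeasurableSet (B i : Set (G i))) {S₀ : Finset ι}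
    (hB1 : ∀ i, i ∉ S₀ → ν i (B i : Set (G i)) = 1) (a : Πʳ i, [G i, B i]) :
    (rpMeasure (fun i => (B i : Set (G i))) ν S₀).map (a * ·) =
      rpMeasure (fun i => (B i : Set (G i))) ν S₀ := by
  classical
  have hKne : ∀ i, ((B i : Set (G i))).Nonempty := fun i => ⟨1, (B i).one_mem⟩
  have hfin : {i | ¬ (a i ∈ (B i : Set (G i)))}.Finite := Filter.eventually_cofinite.1 a.2
  have haT : ∀ i, i ∉ hfin.toFinset → a i ∈ B i :=
    fun i hi => by_contra fun h => hi (hfin.mem_toFinset.2 h)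
  refine ext_of_restrict_rpBox (fun i => (B i : Set (G i))) (S₀ ∪ hfin.toFinset) fun S hS => ?_
  have hS₀ : S₀ ⊆ S := Finset.union_subset_left hS
  have ha : ∀ i, i ∉ S → a i ∈ B i :=
    fun i hi => haT i fun h => hi (hS (Finset.mem_union_right _ h))
  have hB1S : ∀ i, i ∉ S → ν i (B i : Set (G i)) = 1 := fun i hi => hB1 i fun h => hi (hS₀ h)
  have hmeas := measurable_mul_left B hBm a
  haveI := isProbabilityMeasure_rho (fun i => (B i : Set (G i))) ν hKne hBm S
  have hprod : Measurable (Prod.map ((fun i : {i // i ∈ S} => a i) * ·) (mulK B S a ha)) :=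
    (measurable_const_mul _).prodMap (measurable_mulK B S a ha)
  rw [Measure.restrict_map hmeas (measurableSet_rpBox _ hBm S), preimage_mul_left_rpBox B a ha,
    rpMeasure_restrict_rpBox _ ν hKne hBm hB1 hS₀, Measure.map_map hmeas (measurable_glue _ hBm S),
    mul_left_comp_glue B S a ha, ← Measure.map_map (measurable_glue _ hBm S) hprod,
    ← Measure.map_prod_map _ _ (measurable_const_mul _) (measurable_mulK B S a ha),
    map_mul_left_eq_self, map_mulK_rho B ν hKne hBm hB1S a ha]

/-- The restricted product of left-invariant measures is LEFT-INVARIANT. [cite: CasselsFrohlichANT1967, Ch. XV (Tate) §3.3, PDF pp. 352–353] -/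
theorem isMulLeftInvariant_rpMeasure [∀ i, Measure.IsMulLeftInvariant (ν i)]
    (hBm : ∀ i, MeasurableSet (B i : Set (G i))) {S₀ : Finset ι}
    (hB1 : ∀ i, i ∉ S₀ → ν i (B i : Set (G i)) = 1) :
    Measure.IsMulLeftInvariant (rpMeasure (fun i => (B i : Set (G i))) ν S₀) :=
  ⟨fun a => map_mul_left_rpMeasure B ν hBm hB1 a⟩

end invariance

end Literature.MeasureTheory.RestrictedProduct

end
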